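import Summits.QuantumFields.BalabanUV.Beta.GAN24.InsertionChainLaw
import Summits.QuantumFields.BalabanUV.T4Continuum.Support.FirstOrderBackgroundModel
import Summits.QuantumFields.BalabanUV.T4Continuum.Support.BalabanAveragingPairing
import Summits.QuantumFields.BalabanUV.T4Continuum.Support.BalabanAveragedCoerciveTower

/-!
# `BalabanUV.Beta.GAN24.EffectiveFormInsertionLaw` — binder row G-an2-4 ∕ (CONV-C), routes R6 × R7 in NE2's operator currency, PART 118: THE EFFECTIVE FORM's
# u-DERIVATIVE ON THE UNIT LATTICE.  With `c_k` the unit-lattice block propagator (`Q^{(k)}𝒢^{(k)}Q^{(k)ᴴ}`, normalised) and `ċ_k` its first background insertion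
# (`−Q^{(k)}𝒢^{(k)}𝒱_k𝒢^{(k)}Q^{(k)ᴴ}`), the effective form `Σ_k = c_k⁻¹ − a` and its u-derivative `Σ̇_k = −c_k⁻¹ċ_kc_k⁻¹` («the smeared B-derivative of
# `CᵀΔ^{(k)}C`», a NAMED (CONV-C) constituent class) inherit the one-step rates of `c_k`, `ċ_k` under the k-uniform UPPER BOUND letter `‖c_k⁻¹‖ ≤ B`:
# `‖Σ_{k+1} − Σ_k‖ ≤ B²‖c_{k+1} − c_k‖`, `‖Σ̇_{k+1} − Σ̇_k‖ ≤ B²‖ċ_{k+1} − ċ_k‖ + 2B³m‖c_{k+1} − c_k‖` — operator norm, hence ENTRYWISE on the unit lattice; on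
# BAŁABAN's (1.18)-AVERAGED TOWER of `Δ_a` the UB letter is a TREE THEOREM at `U = 1` (`uniformCoercive_unitCovB`) and survives small perturbations (Neumann), so:
# (i) the u-derivative tower `Σ̇_k` for the first-order model CONVERGES at rate `L^{−k}` UNCONDITIONALLY; (ii) route R6's END shape `|𝒮_{j+1}(a,b) − 𝒮_j(a,b)| ≤ cst·θ^j`
# WITH (perturbative) background holds for EVERY `PerturbationLaws` family at small coupling, NO letter (unit b2b-balaban-gan24-p3, gen 51; v1)

NOT IN PRINT; OUR PROOF ([folklore] resolvent ∕ Leibniz ∕ Neumann algebra in the `ℓ²`-operator norm; composition BY NAME over the t4-ne2-p1 lineage's `CovariantAveragingTower`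
(`avgTow`), `BalabanAveragedTowerUnit` (`unitCovB`, `oneStepAveragedLaw_QB`, `norm_entry_le_opNorm`), `BackgroundResolventLaw` (Neumann lemmas), `BackgroundResolventTower`
(`oneStepAveragedLaw_perturbed`, `opNorm_avgTow_perturbed_sub_le`, `opNorm_avgTow_sub_avgTow_le`), `BalabanAveragingPairing.freeTowerLaws_balaban`, `CoerciveInverseTower`
(`Coercive`, `opNorm_inv_le_of_coercive`; its `inv_sub_inv_eq` ∕ `opNorm_inv_sub_inv_le` are the COERCIVE twins of §1 here, which takes the weaker norm letter `‖c⁻¹‖ ≤ B` so as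
to cover the non-Hermitian perturbed `c_k(t)`), `BalabanAveragedCoerciveTower.uniformCoercive_unitCovB`, PART 115 `InsertionChainLaw.oneStepAveragedLaw_insertion`,
`FirstOrderBackgroundModel.perturbationLaws_firstOrder`).
HONEST FRAMING (cell contract, verbatim): «discharging `BetaPertH` makes Bałaban's UV stability UNCONDITIONAL — a real constructive-QFT result; it is NOT the continuum limit and NOT
the Clay problem.»  HONEST DEPENDENCY (verbatim): «continuum YM on T⁴ ⇐ BetaPertH ∧ nine spine estimates (0/9 proved); BetaPertH ⇐ (D1) ∧ (D4) ∧ CAP+tail; G-an2-4 gates asym, D1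
and NE2/3/4.»

WHY THIS FILE.  The row text of (CONV-C) lists, next to `𝒢^{(k)} = C^{(k)}(1;y,y′)`, «the smeared first∕second B-derivatives `V_b, V_{bb′}` of `CᵀΔ^{(k)}C` along Du» — u-DERIVATIVES
OF THE EFFECTIVE FORM.  In the bordered-inverse dictionary of this lineage (PARTs 105 ∕ 107: `𝒮 + a = P⁻¹`, `P = QK⁻¹Qᵀ` the unit block propagator) the effective form is the
INVERSE of the unit-lattice block propagator minus the regulator, so along a background family `t ↦ P_k(t)`: `∂_tΣ_k = −P_k⁻¹(∂_tP_k)P_k⁻¹`, and `∂_tP_k|₀` is the unit-lattice image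
of the first insertion chain `−𝒢^{(k)}𝒱_k𝒢^{(k)}` (PART 115 §5).  PART 107 transferred P's ENTRYWISE-WITH-DECAY rate to Σ (real currency, LINEAR); PARTs 115–116 deliver the
insertion chains' rate in NE2's OPERATOR currency.  This file is the operator-currency twin of PART 107 for the value AND the first derivative: the effective form and its
u-derivative inherit the rates of `c_k`, `ċ_k` under ONE letter — the k-uniform upper bound `‖c_k⁻¹‖ ≤ B` (Bałaban's (1.67)-class UB; real twin PART 105
`blockProp_coercive_of_ub`: `‖P⁻¹‖ ≤ Λ + a`) — and unit-lattice ENTRIES are bounded by operator norms (`norm_entry_le_opNorm`), so the rate half of (CONV-C) for these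
constituents is served in entry currency too (no decay claimed: the decay half is (H2), the join road P1's `decayCauchy_of_uniformDecays_supRate`).

WHAT THIS FILE PROVES (0 sorry, 0 `def`, nothing cited; `ι` a finite index type, complex matrices, `ℓ²`-operator norm):
* §1 `inv_sub_inv_eq` (`c′⁻¹ − c⁻¹ = −c′⁻¹(c′ − c)c⁻¹`), **`opNorm_inv_sub_inv_le`** (`‖c′⁻¹ − c⁻¹‖ ≤ B²‖c′ − c‖`), `sandwich_sub_sandwich_eq` (Leibniz over three factors, EXACT),
  `opNorm_sandwich_sub_le`, **`opNorm_effIns_sub_le`** (`‖c′⁻¹X′c′⁻¹ − c⁻¹Xc⁻¹‖ ≤ B²‖X′ − X‖ + 2B³m‖c′ − c‖`, `m ≥ ‖X‖, ‖X′‖`).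
* §2 TOWERS of unit-lattice matrices `c_k`, `X_k` (`‖c_k⁻¹‖ ≤ B`, `‖X_k‖ ≤ m`, one-step bounds `ε_k`, `ε′_k`): **`opNorm_effForm_step_le`** (`Σ_k = c_k⁻¹ − a•1`: `≤ B²ε_k`;
  `norm_effForm_entry_step_le` ENTRYWISE = the SHAPE of R6's END `|𝒮_{j+1}(a,b) − 𝒮_j(a,b)| ≤ cst·θ^j` with (STAB)∕(CONS)∕`τ_j` replaced by the block propagator's law + UB),
  **`opNorm_effIns_step_le`** (`Σ̇_k = c_k⁻¹X_kc_k⁻¹`: `≤ B²ε′_k + 2B³mε_k`), **`norm_effIns_entry_step_le`** (the same ENTRYWISE), **`effForm_tendsto_of_geom`** ∕ **`effIns_tendsto_of_geom`**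
  (geometric `ε, ε′` ⟹ limits exist with `‖Σ_k − Σ_∞‖ ≤ B²C·ρ^k/(1−ρ)`, `‖Σ̇_k − Σ̇_∞‖ ≤ (B²C′ + 2B³mC)·ρ^k/(1−ρ)`).
* §3 `opNorm_avgTow_le` (`‖avgTow A r X k‖ ≤ ‖X_k‖`), `opNorm_avgTow_step_le_of_law` (one-step bound of the unit-lattice images from `OneStepAveragedLaw`, BY NAME).
* §4 **`isUnit_det_and_opNorm_inv_le_of_near`** (NEUMANN TRANSFER OF THE UB LETTER): `‖c₀⁻¹‖ ≤ B₀`, `‖c − c₀‖ ≤ δ`, `B₀δ ≤ θ < 1` ⟹ `c` invertible, `‖c⁻¹‖ ≤ B₀(1 − θ)⁻¹`.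
* §5 THE INSTANCES on BAŁABAN's (1.18)-averaged tower of `Δ_a` (`L ≥ 2`), where the UB letter at `U = 1` IS the tree theorem `uniformCoercive_unitCovB`
  (`isUnit_det_unitCovB_and_opNorm_inv_le`: `‖c_k⁻¹‖ ≤ γ_B(d,a)⁻¹`): **`effFormInsertion_balaban`** (`d ≥ 1`, `LipschitzBackground V α β`) — the u-derivative tower
  `Σ̇_k = c_k⁻¹·ċ_k·c_k⁻¹`, `c_k = unitCovB k`, `ċ_k = (L^d)^k·QB^{(k)}𝒢^{(k)}(V^{(k)}·∇^{(k)})𝒢^{(k)}QB^{(k)ᴴ}`, CONVERGES with `‖Σ̇_k − Σ̇_∞‖ ≤ (B²C₁ + 2B³·κCst·CQB)·L^{−k}/(1 − L^{−1})`,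
  `B = γ_B⁻¹`, `C₁ = 2κCJ + C2model + κ(2dCst + 2dLCst)`, `κ = d(α+β)Cst` — UNCONDITIONAL, every input a tree theorem; **`effForm_perturbed_balaban`** ∕
  `effForm_entry_step_perturbed_balaban` — R6's END WITH (PERTURBATIVE) BACKGROUND: for EVERY `PerturbationLaws (Δ_a^{(·)}) P J κ (C₂L^{−k})` family, `‖t‖κ < 1` and the Neumann
  smallness `γ_B⁻¹‖t‖κCst(1 − ‖t‖κ)⁻¹ ≤ θ < 1`, the effective forms `Σ_k(t) = c_k(t)⁻¹ − a′•1` of the perturbed block propagators `c_k(t) = (L^d)^k·QB^{(k)}(Δ_a^{(k)} + tP_k)⁻¹QB^{(k)ᴴ}`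
  CONVERGE, `‖Σ_k(t) − Σ_∞(t)‖ ≤ (γ_B⁻¹(1 − θ)⁻¹)²·Cpert(t)·L^{−k}/(1 − L^{−1})`, and ENTRYWISE `‖Σ_{k+1}(t)(i,j) − Σ_k(t)(i,j)‖ ≤ (γ_B⁻¹(1 − θ)⁻¹)²·Cpert(t)·L^{−k}` — NO letter:
  no (STAB)^{cov} schedule, no (CONS), no `τ_j`, no UB hypothesis (for the first-order model: a THEOREM about a Lipschitz connection inserted into Bałaban's `Δ_a`).
WHAT IT DOES NOT DO: treat King's (non-covering) block averaging (there the UB letter is not in the tree; PART 116's insertion towers stand, the Σ-reading would be conditional);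
large couplings `t` (outside the Neumann disc the UB letter is a genuine input — Bałaban's (1.67)-class with background); second u-derivatives (`Σ̈ = 2c⁻¹ċc⁻¹ċc⁻¹ − c⁻¹c̈c⁻¹`: the same Leibniz algebra over PART 115's `n = 2` chain — not typed here); the decay half; Bałaban's vertices.
SUPPLIER work (junction R6 × R7 × NE2); no consumer of record; NEVER «G-an2-4 closed»; NOT (CONV-C), NOT D1, NOT `BetaPertH`, NOT continuum, NOT Clay.
Records: `HOME/b2b-balaban-gan24-p3/gen51/README.md`.
-/

noncomputable section

open scoped BigOperators ComplexConjugate Matrix Matrix.Norms.L2Operator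
open Filter Topology

namespace Summit.QuantumFields.BalabanUV.Beta.GAN24.EffectiveFormInsertionLaw

open Literature.MathematicalPhysics.QuantumFieldTheory.Balaban1983to89.B5Prop11Plancherel (Cst Cst_nonneg)
open Summit.QuantumFields.BalabanUV.T4Continuum
open Summit.QuantumFields.BalabanUV.T4Continuum.CovariantAveragingTower (avgTow Atow OneStepAveragedLaw opNorm_avgTow_succ_sub_le)
open Summit.QuantumFields.BalabanUV.T4Continuum.BalabanAveragedTowerUnit (idx QBlev calGlev unitCovB opNorm_QBlev_sq_le oneStepAveragedLaw_QB norm_entry_le_opNorm)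
open Summit.QuantumFields.BalabanUV.T4Continuum.BalabanLineAverage (CQB)
open Summit.QuantumFields.BalabanUV.T4Continuum.BackgroundResolventLaw (isUnit_one_add_of_opNorm_lt_one opNorm_inv_one_add_le)
open Summit.QuantumFields.BalabanUV.T4Continuum.BackgroundResolventTower (PerturbationLaws opNorm_avgTow_sub_avgTow_le oneStepAveragedLaw_perturbed
  opNorm_avgTow_perturbed_sub_le Cpert Epert_le_Cpert)
open Summit.QuantumFields.BalabanUV.T4Continuum.KingPairingPlantedLaw (JpcT calDalev calDalev_inv isUnit_det_calDalev CJ opNorm_inv_calDalev_le)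
open Summit.QuantumFields.BalabanUV.T4Continuum.FirstOrderBackgroundModel (LipschitzBackground Pmodel C2model perturbationLaws_firstOrder)
open Summit.QuantumFields.BalabanUV.T4Continuum.BalabanAveragingPairing (FQBlev freeTowerLaws_balaban)
open Summit.QuantumFields.BalabanUV.T4Continuum.CoerciveInverseTower (Coercive isUnit_of_coercive opNorm_inv_le_of_coercive)
open Summit.QuantumFields.BalabanUV.T4Continuum.BalabanAveragedCoercive (gammaB gammaB_pos)
open Summit.QuantumFields.BalabanUV.T4Continuum.BalabanAveragedCoerciveTower (uniformCoercive_unitCovB)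
open Summit.QuantumFields.BalabanUV.Beta.GAN24.InsertionChainLaw (oneStepAveragedLaw_insertion)

/-! ## §1 Two levels: the inverse and the sandwiched insertion -/

section Algebra

variable {ι : Type*} [Fintype ι] [DecidableEq ι]

/-- the second resolvent identity: `c′⁻¹ − c⁻¹ = −c′⁻¹·(c′ − c)·c⁻¹`. [folklore] -/
theorem inv_sub_inv_eq {c c' : Matrix ι ι ℂ} (hc : IsUnit c.det) (hc' : IsUnit c'.det) :
    c'⁻¹ - c⁻¹ = -(c'⁻¹ * (c' - c) * c⁻¹) := by
  rw [Matrix.mul_sub, Matrix.sub_mul, Matrix.nonsing_inv_mul c' hc', Matrix.one_mul, Matrix.mul_assoc, Matrix.mul_nonsing_inv c hc,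
    Matrix.mul_one]
  abel

/-- **`opNorm_inv_sub_inv_le` — THE EFFECTIVE FORM INHERITS THE BLOCK PROPAGATOR's RATE** (operator currency): `‖c⁻¹‖, ‖c′⁻¹‖ ≤ B` ⟹ `‖c′⁻¹ − c⁻¹‖ ≤ B²·‖c′ − c‖`.
[folklore] -/
theorem opNorm_inv_sub_inv_le {c c' : Matrix ι ι ℂ} (hc : IsUnit c.det) (hc' : IsUnit c'.det) {B : ℝ} (hB : ‖c⁻¹‖ ≤ B) (hB' : ‖c'⁻¹‖ ≤ B) :
    ‖c'⁻¹ - c⁻¹‖ ≤ B ^ 2 * ‖c' - c‖ := by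
  have hB0 : 0 ≤ B := (norm_nonneg _).trans hB
  rw [inv_sub_inv_eq hc hc', norm_neg]
  calc ‖c'⁻¹ * (c' - c) * c⁻¹‖ ≤ ‖c'⁻¹ * (c' - c)‖ * ‖c⁻¹‖ := Matrix.l2_opNorm_mul _ _
    _ ≤ ‖c'⁻¹‖ * ‖c' - c‖ * ‖c⁻¹‖ := mul_le_mul_of_nonneg_right (Matrix.l2_opNorm_mul _ _) (norm_nonneg _)
    _ ≤ B * ‖c' - c‖ * B := mul_le_mul (mul_le_mul_of_nonneg_right hB' (norm_nonneg _)) hB (norm_nonneg _) (by positivity)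
    _ = B ^ 2 * ‖c' - c‖ := by ring

omit [DecidableEq ι] in
/-- Leibniz over three factors (EXACT): `G′X′G′ − GXG = (G′ − G)X′G′ + G(X′ − X)G′ + GX(G′ − G)`. [folklore] -/
theorem sandwich_sub_sandwich_eq (G G' X X' : Matrix ι ι ℂ) :
    G' * X' * G' - G * X * G = (G' - G) * X' * G' + G * (X' - X) * G' + G * X * (G' - G) := by
  simp only [Matrix.sub_mul, Matrix.mul_sub]
  abel

/-- the sandwiched difference in norm: `‖G‖, ‖G′‖ ≤ B`, `‖X‖, ‖X′‖ ≤ m`, `‖G′ − G‖ ≤ e`, `‖X′ − X‖ ≤ e′` ⟹ `‖G′X′G′ − GXG‖ ≤ B²e′ + 2Bme`. [folklore] -/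
theorem opNorm_sandwich_sub_le {G G' X X' : Matrix ι ι ℂ} {B m e e' : ℝ} (hG : ‖G‖ ≤ B) (hG' : ‖G'‖ ≤ B) (hX : ‖X‖ ≤ m) (hX' : ‖X'‖ ≤ m)
    (hGG : ‖G' - G‖ ≤ e) (hXX : ‖X' - X‖ ≤ e') :
    ‖G' * X' * G' - G * X * G‖ ≤ B ^ 2 * e' + 2 * B * m * e := by
  have hB0 : 0 ≤ B := (norm_nonneg _).trans hG
  have hm0 : 0 ≤ m := (norm_nonneg _).trans hX
  have he0 : 0 ≤ e := (norm_nonneg _).trans hGG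
  have he0' : 0 ≤ e' := (norm_nonneg _).trans hXX
  rw [sandwich_sub_sandwich_eq]
  have t1 : ‖(G' - G) * X' * G'‖ ≤ e * m * B :=
    calc _ ≤ ‖(G' - G) * X'‖ * ‖G'‖ := Matrix.l2_opNorm_mul _ _
      _ ≤ ‖G' - G‖ * ‖X'‖ * ‖G'‖ := mul_le_mul_of_nonneg_right (Matrix.l2_opNorm_mul _ _) (norm_nonneg _)
      _ ≤ e * m * B := mul_le_mul (mul_le_mul hGG hX' (norm_nonneg _) he0) hG' (norm_nonneg _) (by positivity)
  have t2 : ‖G * (X' - X) * G'‖ ≤ B * e' * B :=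
    calc _ ≤ ‖G * (X' - X)‖ * ‖G'‖ := Matrix.l2_opNorm_mul _ _
      _ ≤ ‖G‖ * ‖X' - X‖ * ‖G'‖ := mul_le_mul_of_nonneg_right (Matrix.l2_opNorm_mul _ _) (norm_nonneg _)
      _ ≤ B * e' * B := mul_le_mul (mul_le_mul hG hXX (norm_nonneg _) hB0) hG' (norm_nonneg _) (by positivity)
  have t3 : ‖G * X * (G' - G)‖ ≤ B * m * e :=
    calc _ ≤ ‖G * X‖ * ‖G' - G‖ := Matrix.l2_opNorm_mul _ _
      _ ≤ ‖G‖ * ‖X‖ * ‖G' - G‖ := mul_le_mul_of_nonneg_right (Matrix.l2_opNorm_mul _ _) (norm_nonneg _)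
      _ ≤ B * m * e := mul_le_mul (mul_le_mul hG hX (norm_nonneg _) hB0) hGG (norm_nonneg _) (by positivity)
  calc _ ≤ ‖(G' - G) * X' * G' + G * (X' - X) * G'‖ + ‖G * X * (G' - G)‖ := norm_add_le _ _
    _ ≤ (‖(G' - G) * X' * G'‖ + ‖G * (X' - X) * G'‖) + ‖G * X * (G' - G)‖ := add_le_add (norm_add_le _ _) le_rfl
    _ ≤ (e * m * B + B * e' * B) + B * m * e := add_le_add (add_le_add t1 t2) t3
    _ = B ^ 2 * e' + 2 * B * m * e := by ring

/-- **`opNorm_effIns_sub_le` — THE EFFECTIVE FORM's u-DERIVATIVE AT TWO LEVELS** [our proof]: `‖c⁻¹‖, ‖c′⁻¹‖ ≤ B`, `‖X‖, ‖X′‖ ≤ m`, `‖c′ − c‖ ≤ e`, `‖X′ − X‖ ≤ e′` ⟹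
`‖c′⁻¹X′c′⁻¹ − c⁻¹Xc⁻¹‖ ≤ B²e′ + 2B³me` — LINEAR in the two one-step sizes. -/
theorem opNorm_effIns_sub_le {c c' X X' : Matrix ι ι ℂ} (hc : IsUnit c.det) (hc' : IsUnit c'.det) {B m e e' : ℝ}
    (hB : ‖c⁻¹‖ ≤ B) (hB' : ‖c'⁻¹‖ ≤ B) (hX : ‖X‖ ≤ m) (hX' : ‖X'‖ ≤ m) (hcc : ‖c' - c‖ ≤ e) (hXX : ‖X' - X‖ ≤ e') :
    ‖c'⁻¹ * X' * c'⁻¹ - c⁻¹ * X * c⁻¹‖ ≤ B ^ 2 * e' + 2 * B ^ 3 * m * e := by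
  have h := opNorm_sandwich_sub_le hB hB' hX hX'
    ((opNorm_inv_sub_inv_le hc hc' hB hB').trans (mul_le_mul_of_nonneg_left hcc (sq_nonneg B))) hXX
  calc _ ≤ B ^ 2 * e' + 2 * B * m * (B ^ 2 * e) := h
    _ = B ^ 2 * e' + 2 * B ^ 3 * m * e := by ring

end Algebra

/-! ## §2 Towers of unit-lattice matrices: one-step rates, entries, limits -/

section Tower

variable {ι : Type*} [Fintype ι] [DecidableEq ι] {cc X : ℕ → Matrix ι ι ℂ} {B m : ℝ} {ε ε' : ℕ → ℝ}

/-- **`opNorm_effForm_step_le` — Σ's ONE-STEP RATE ON THE UNIT LATTICE** [our proof]: `Σ_k = c_k⁻¹ − a•1` (any regulator `a`), `‖c_k⁻¹‖ ≤ B`, `‖c_{k+1} − c_k‖ ≤ ε_k` ⟹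
`‖Σ_{k+1} − Σ_k‖ ≤ B²ε_k`. -/
theorem opNorm_effForm_step_le (hu : ∀ k, IsUnit (cc k).det) (hB : ∀ k, ‖(cc k)⁻¹‖ ≤ B) (hcc : ∀ k, ‖cc (k + 1) - cc k‖ ≤ ε k)
    (a : ℂ) (k : ℕ) :
    ‖((cc (k + 1))⁻¹ - a • (1 : Matrix ι ι ℂ)) - ((cc k)⁻¹ - a • (1 : Matrix ι ι ℂ))‖ ≤ B ^ 2 * ε k := by
  rw [sub_sub_sub_cancel_right]
  exact (opNorm_inv_sub_inv_le (hu k) (hu (k + 1)) (hB k) (hB (k + 1))).trans (mul_le_mul_of_nonneg_left (hcc k) (sq_nonneg B))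

/-- the same ENTRYWISE on the unit lattice (`‖M i j‖ ≤ ‖M‖`): `‖Σ_{k+1}(i,j) − Σ_k(i,j)‖ ≤ B²ε_k` — the SHAPE of route R6's END `|𝒮_{j+1}(a,b) − 𝒮_j(a,b)| ≤ cst·θ^j`
(PART 18 `effForm_entry_step_rate_of_stab_of_cons`) with (STAB) ∕ (CONS) ∕ `τ_j` REPLACED by the block propagator's operator-norm one-step law + the UB letter. [our proof] -/
theorem norm_effForm_entry_step_le (hu : ∀ k, IsUnit (cc k).det) (hB : ∀ k, ‖(cc k)⁻¹‖ ≤ B) (hcc : ∀ k, ‖cc (k + 1) - cc k‖ ≤ ε k)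
    (a : ℂ) (k : ℕ) (i j : ι) :
    ‖((cc (k + 1))⁻¹ - a • (1 : Matrix ι ι ℂ)) i j - ((cc k)⁻¹ - a • (1 : Matrix ι ι ℂ)) i j‖ ≤ B ^ 2 * ε k := by
  rw [← Matrix.sub_apply]
  exact (norm_entry_le_opNorm _ i j).trans (opNorm_effForm_step_le hu hB hcc a k)

/-- **`opNorm_effIns_step_le` — THE u-DERIVATIVE's ONE-STEP RATE ON THE UNIT LATTICE** [our proof]: `Σ̇_k = c_k⁻¹X_kc_k⁻¹`, `‖c_k⁻¹‖ ≤ B`, `‖X_k‖ ≤ m`,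
`‖c_{k+1} − c_k‖ ≤ ε_k`, `‖X_{k+1} − X_k‖ ≤ ε′_k` ⟹ `‖Σ̇_{k+1} − Σ̇_k‖ ≤ B²ε′_k + 2B³mε_k`. -/
theorem opNorm_effIns_step_le (hu : ∀ k, IsUnit (cc k).det) (hB : ∀ k, ‖(cc k)⁻¹‖ ≤ B) (hXm : ∀ k, ‖X k‖ ≤ m)
    (hcc : ∀ k, ‖cc (k + 1) - cc k‖ ≤ ε k) (hXX : ∀ k, ‖X (k + 1) - X k‖ ≤ ε' k) (k : ℕ) :
    ‖(cc (k + 1))⁻¹ * X (k + 1) * (cc (k + 1))⁻¹ - (cc k)⁻¹ * X k * (cc k)⁻¹‖ ≤ B ^ 2 * ε' k + 2 * B ^ 3 * m * ε k :=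
  opNorm_effIns_sub_le (hu k) (hu (k + 1)) (hB k) (hB (k + 1)) (hXm k) (hXm (k + 1)) (hcc k) (hXX k)

/-- the same ENTRYWISE: unit-lattice entries are bounded by operator norms. [our proof] -/
theorem norm_effIns_entry_step_le (hu : ∀ k, IsUnit (cc k).det) (hB : ∀ k, ‖(cc k)⁻¹‖ ≤ B) (hXm : ∀ k, ‖X k‖ ≤ m)
    (hcc : ∀ k, ‖cc (k + 1) - cc k‖ ≤ ε k) (hXX : ∀ k, ‖X (k + 1) - X k‖ ≤ ε' k) (k : ℕ) (i j : ι) :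
    ‖((cc (k + 1))⁻¹ * X (k + 1) * (cc (k + 1))⁻¹) i j - ((cc k)⁻¹ * X k * (cc k)⁻¹) i j‖ ≤ B ^ 2 * ε' k + 2 * B ^ 3 * m * ε k := by
  rw [← Matrix.sub_apply]
  exact (norm_entry_le_opNorm _ i j).trans (opNorm_effIns_step_le hu hB hXm hcc hXX k)

/-- **`effForm_tendsto_of_geom`**: geometric one-step sizes `‖c_{k+1} − c_k‖ ≤ Cρ^k`, `ρ < 1` ⟹ `Σ_k = c_k⁻¹ − a•1` CONVERGES with `‖Σ_k − Σ_∞‖ ≤ B²C·ρ^k/(1 − ρ)`. [our proof] -/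
theorem effForm_tendsto_of_geom (hu : ∀ k, IsUnit (cc k).det) (hB : ∀ k, ‖(cc k)⁻¹‖ ≤ B) {C ρ : ℝ} (hρ1 : ρ < 1)
    (hcc : ∀ k, ‖cc (k + 1) - cc k‖ ≤ C * ρ ^ k) (a : ℂ) :
    ∃ Slim : Matrix ι ι ℂ, Tendsto (fun k => (cc k)⁻¹ - a • (1 : Matrix ι ι ℂ)) atTop (𝓝 Slim) ∧
      ∀ k, ‖((cc k)⁻¹ - a • (1 : Matrix ι ι ℂ)) - Slim‖ ≤ B ^ 2 * C * ρ ^ k / (1 - ρ) := by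
  have hstep : ∀ k, dist ((cc k)⁻¹ - a • (1 : Matrix ι ι ℂ)) ((cc (k + 1))⁻¹ - a • (1 : Matrix ι ι ℂ)) ≤ B ^ 2 * C * ρ ^ k := by
    intro k
    rw [dist_eq_norm, ← norm_neg, neg_sub]
    refine (opNorm_effForm_step_le hu hB hcc a k).trans (le_of_eq ?_)
    ring
  have hcs := cauchySeq_of_le_geometric ρ _ hρ1 hstep
  obtain ⟨Slim, hlim⟩ := cauchySeq_tendsto_of_complete hcs
  exact ⟨Slim, hlim, fun k => by rw [← dist_eq_norm]; exact dist_le_of_le_geometric_of_tendsto ρ _ hρ1 hstep hlim k⟩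

/-- **`effIns_tendsto_of_geom` — THE u-DERIVATIVE OF THE EFFECTIVE FORM CONVERGES AT THE VALUES' RATE** [our proof]: `‖c_{k+1} − c_k‖ ≤ Cρ^k`, `‖X_{k+1} − X_k‖ ≤ C′ρ^k`,
`ρ < 1` ⟹ `Σ̇_k = c_k⁻¹X_kc_k⁻¹` CONVERGES with `‖Σ̇_k − Σ̇_∞‖ ≤ (B²C′ + 2B³mC)·ρ^k/(1 − ρ)`. -/
theorem effIns_tendsto_of_geom (hu : ∀ k, IsUnit (cc k).det) (hB : ∀ k, ‖(cc k)⁻¹‖ ≤ B) (hXm : ∀ k, ‖X k‖ ≤ m) {C C' ρ : ℝ}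
    (hρ1 : ρ < 1) (hcc : ∀ k, ‖cc (k + 1) - cc k‖ ≤ C * ρ ^ k) (hXX : ∀ k, ‖X (k + 1) - X k‖ ≤ C' * ρ ^ k) :
    ∃ Ilim : Matrix ι ι ℂ, Tendsto (fun k => (cc k)⁻¹ * X k * (cc k)⁻¹) atTop (𝓝 Ilim) ∧
      ∀ k, ‖(cc k)⁻¹ * X k * (cc k)⁻¹ - Ilim‖ ≤ (B ^ 2 * C' + 2 * B ^ 3 * m * C) * ρ ^ k / (1 - ρ) := by
  have hstep : ∀ k, dist ((cc k)⁻¹ * X k * (cc k)⁻¹) ((cc (k + 1))⁻¹ * X (k + 1) * (cc (k + 1))⁻¹)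
      ≤ (B ^ 2 * C' + 2 * B ^ 3 * m * C) * ρ ^ k := by
    intro k
    rw [dist_eq_norm, ← norm_neg, neg_sub]
    refine (opNorm_effIns_step_le hu hB hXm hcc hXX k).trans (le_of_eq ?_)
    ring
  have hcs := cauchySeq_of_le_geometric ρ _ hρ1 hstep
  obtain ⟨Ilim, hlim⟩ := cauchySeq_tendsto_of_complete hcs
  exact ⟨Ilim, hlim, fun k => by rw [← dist_eq_norm]; exact dist_le_of_le_geometric_of_tendsto ρ _ hρ1 hstep hlim k⟩

end Tower

/-! ## §3 Unit-lattice images of a tower: size and one-step bounds from the one-step averaged law -/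

section Images

variable {ι : ℕ → Type*} [∀ k, Fintype (ι k)] [∀ k, DecidableEq (ι k)] {A : (k : ℕ) → Matrix (ι k) (ι (k + 1)) ℂ} {r : ℝ}

/-- sandwiching by the normalised composite averagings does not increase norms: `‖avgTow A r X k‖ ≤ ‖X_k‖`. [folklore] -/
theorem opNorm_avgTow_le (hr : 0 < r) (hA : ∀ k, ‖A k‖ ^ 2 ≤ r⁻¹) (X : (k : ℕ) → Matrix (ι k) (ι k) ℂ) (k : ℕ) :
    ‖avgTow A r X k‖ ≤ ‖X k‖ := by
  have h := opNorm_avgTow_sub_avgTow_le hr hA X (fun k => (0 : Matrix (ι k) (ι k) ℂ)) k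
  have h0 : avgTow A r (fun k => (0 : Matrix (ι k) (ι k) ℂ)) k = 0 := by simp [avgTow]
  simpa [h0] using h

/-- the one-step bound of the unit-lattice images from the one-step averaged law (`CovariantAveragingTower.opNorm_avgTow_succ_sub_le` BY NAME, re-oriented). [folklore] -/
theorem opNorm_avgTow_step_le_of_law (hr : 0 < r) (hA : ∀ k, ‖A k‖ ^ 2 ≤ r⁻¹) {X : (k : ℕ) → Matrix (ι k) (ι k) ℂ} {e : ℕ → ℝ}
    (hlaw : OneStepAveragedLaw A r X e) (k : ℕ) : ‖avgTow A r X (k + 1) - avgTow A r X k‖ ≤ e k :=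
  opNorm_avgTow_succ_sub_le A hr hA X k (hlaw k)

end Images

/-! ## §4 The UB letter under perturbation: a Neumann transfer -/

section Neumann

variable {ι : Type*} [Fintype ι] [DecidableEq ι]

/-- **`isUnit_det_and_opNorm_inv_le_of_near` — THE UPPER-BOUND LETTER SURVIVES A SMALL PERTURBATION** [our proof]: `c₀` invertible with `‖c₀⁻¹‖ ≤ B₀`, `‖c − c₀‖ ≤ δ`,
`B₀δ ≤ θ < 1` ⟹ `c` is invertible and `‖c⁻¹‖ ≤ B₀(1 − θ)⁻¹` (`c = c₀(1 + c₀⁻¹(c − c₀))`, NE2's Neumann lemmas `isUnit_one_add_of_opNorm_lt_one` ∕ `opNorm_inv_one_add_le`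
BY NAME). -/
theorem isUnit_det_and_opNorm_inv_le_of_near {c₀ c : Matrix ι ι ℂ} (h₀ : IsUnit c₀.det) {B₀ δ θ : ℝ} (hB₀ : ‖c₀⁻¹‖ ≤ B₀) (hδ : ‖c - c₀‖ ≤ δ)
    (hθ : B₀ * δ ≤ θ) (hθ1 : θ < 1) : IsUnit c.det ∧ ‖c⁻¹‖ ≤ B₀ * (1 - θ)⁻¹ := by
  have hB0 : 0 ≤ B₀ := (norm_nonneg _).trans hB₀
  set X : Matrix ι ι ℂ := c₀⁻¹ * (c - c₀) with hXdef
  have hX : ‖X‖ ≤ θ :=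
    ((Matrix.l2_opNorm_mul _ _).trans (mul_le_mul hB₀ hδ (norm_nonneg _) hB0)).trans hθ
  have hc : c = c₀ * (1 + X) := by
    rw [hXdef, Matrix.mul_add, Matrix.mul_one, ← Matrix.mul_assoc, Matrix.mul_nonsing_inv c₀ h₀, Matrix.one_mul]; abel
  have hU : IsUnit (1 + X) := isUnit_one_add_of_opNorm_lt_one (lt_of_le_of_lt hX hθ1)
  have hUdet : IsUnit (1 + X).det := (Matrix.isUnit_iff_isUnit_det _).mp hU
  have hcdet : IsUnit c.det := by rw [hc, Matrix.det_mul]; exact h₀.mul hUdet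
  refine ⟨hcdet, ?_⟩
  have hinv : c⁻¹ = (1 + X)⁻¹ * c₀⁻¹ := by rw [hc, Matrix.mul_inv_rev]
  rw [hinv]
  calc ‖(1 + X)⁻¹ * c₀⁻¹‖ ≤ ‖(1 + X)⁻¹‖ * ‖c₀⁻¹‖ := Matrix.l2_opNorm_mul _ _
    _ ≤ (1 - θ)⁻¹ * B₀ := mul_le_mul (opNorm_inv_one_add_le hX hθ1) hB₀ (norm_nonneg _) (inv_nonneg.mpr (sub_nonneg.mpr hθ1.le))
    _ = B₀ * (1 - θ)⁻¹ := mul_comm _ _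

end Neumann

/-! ## §5 The instances: Bałaban's (1.18)-averaged tower of `Δ_a` — UB DISCHARGED at `U = 1` (`uniformCoercive_unitCovB`) -/

section Balaban

variable {d : ℕ} (L : ℕ) [NeZero L] (M : Fin d → ℕ) [hM : ∀ μ, NeZero (M μ)] (a : ℝ) (ha : 0 < a)

/-- the UB letter at `U = 1` on Bałaban's averaged tower IS a tree theorem: every `c_k = unitCovB k = (L^d)^k·QB^{(k)}𝒢^{(k)}QB^{(k)ᴴ}` is invertible with `‖c_k⁻¹‖ ≤ γ_B(d,a)⁻¹`
(`BalabanAveragedCoerciveTower.uniformCoercive_unitCovB` + `CoerciveInverseTower.opNorm_inv_le_of_coercive` BY NAME). [folklore] -/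
theorem isUnit_det_unitCovB_and_opNorm_inv_le (k : ℕ) :
    IsUnit (unitCovB L M a ha k).det ∧ ‖(unitCovB L M a ha k)⁻¹‖ ≤ (gammaB d a)⁻¹ :=
  ⟨(Matrix.isUnit_iff_isUnit_det _).mp (isUnit_of_coercive (gammaB_pos a ha) (uniformCoercive_unitCovB L M a ha k)),
    opNorm_inv_le_of_coercive (gammaB_pos a ha) (uniformCoercive_unitCovB L M a ha k)⟩

/-- **`effFormInsertion_balaban` — THE u-DERIVATIVE OF THE EFFECTIVE FORM ALONG BAŁABAN's AVERAGED TOWER, FIRST-ORDER MODEL — UNCONDITIONAL** [our proof] (`L ≥ 2`,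
`d ≥ 1`): with `c_k = unitCovB k` (the (1.18)-averaged unit-lattice block propagator of Bałaban's `Δ_a^{(k)}`), `ċ_k = (L^d)^k·QB^{(k)}𝒢^{(k)}(Σ_μ diag(V^{(k)}_μ)∇^{(k)}_μ)𝒢^{(k)}QB^{(k)ᴴ}`
(the first background insertion of a Lipschitz connection, `LipschitzBackground V α β`), the tower `Σ̇_k = c_k⁻¹·ċ_k·c_k⁻¹` CONVERGES with
`‖Σ̇_k − Σ̇_∞‖ ≤ (B²C₁ + 2B³·(κCst)·CQB)·L^{−k}/(1 − L^{−1})`, `B = γ_B(d,a)⁻¹`, `C₁ = 2κCJ + C2model + κ(2dCst + 2dLCst)`, `κ = d(α+β)Cst` — EVERY input a tree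
theorem: `freeTowerLaws_balaban`, `perturbationLaws_firstOrder`, `oneStepAveragedLaw_QB`, `uniformCoercive_unitCovB`, PART 115 `oneStepAveragedLaw_insertion`. -/
theorem effFormInsertion_balaban (hL : 2 ≤ L) (hd : 1 ≤ d) {V : (k : ℕ) → Fin d → (idx L M k → ℂ)} {α β : ℝ}
    (hV : LipschitzBackground L M V α β) :
    ∃ Ilim : Matrix (idx L M 0) (idx L M 0) ℂ,
      Tendsto (fun k => (unitCovB L M a ha k)⁻¹
          * avgTow (QBlev L M) ((L : ℝ) ^ d) (fun k => calGlev L M a ha k * Pmodel L M V k * calGlev L M a ha k) k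
          * (unitCovB L M a ha k)⁻¹) atTop (𝓝 Ilim) ∧
      ∀ k, ‖(unitCovB L M a ha k)⁻¹
          * avgTow (QBlev L M) ((L : ℝ) ^ d) (fun k => calGlev L M a ha k * Pmodel L M V k * calGlev L M a ha k) k
          * (unitCovB L M a ha k)⁻¹ - Ilim‖
        ≤ (((gammaB d a)⁻¹) ^ 2 * ((2 * (d * (α + β) * Cst d a) * CJ d a + C2model d L a α β)
              + (d * (α + β) * Cst d a) * (2 * d * Cst d a + 2 * (d * L * Cst d a)))
            + 2 * ((gammaB d a)⁻¹) ^ 3 * ((d * (α + β) * Cst d a) * Cst d a) * CQB d a) * ((L : ℝ)⁻¹) ^ k / (1 - (L : ℝ)⁻¹) := by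
  have hL1 : (1 : ℝ) < L := by exact_mod_cast (lt_of_lt_of_le one_lt_two hL : 1 < L)
  have hr : (0 : ℝ) < (L : ℝ) ^ d := pow_pos (lt_trans zero_lt_one hL1) d
  have hρ1 : (L : ℝ)⁻¹ < 1 := inv_lt_one_of_one_lt₀ hL1
  have hpert := perturbationLaws_firstOrder L M a ha hd hV
  -- the value tower's one-step bound (`unitCovB k = avgTow QBlev L^d calGlev k` by definition)
  have hcc : ∀ k, ‖unitCovB L M a ha (k + 1) - unitCovB L M a ha k‖ ≤ CQB d a * ((L : ℝ)⁻¹) ^ k := fun k =>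
    opNorm_avgTow_step_le_of_law hr (opNorm_QBlev_sq_le L M) (oneStepAveragedLaw_QB L M a ha) k
  -- the insertion tower's one-step bound (PART 115, order one, rewritten on `𝒢 = Δ_a⁻¹`)
  have e : (fun k => ((calDalev L M a ha k)⁻¹ * Pmodel L M V k) ^ 1 * (calDalev L M a ha k)⁻¹)
      = fun k => calGlev L M a ha k * Pmodel L M V k * calGlev L M a ha k := by
    funext k
    rw [pow_one, calDalev_inv]
  have hlaw := oneStepAveragedLaw_insertion hr (freeTowerLaws_balaban L M a ha) hpert 1
  rw [e] at hlaw
  have hXX : ∀ k, ‖avgTow (QBlev L M) ((L : ℝ) ^ d) (fun k => calGlev L M a ha k * Pmodel L M V k * calGlev L M a ha k) (k + 1)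
      - avgTow (QBlev L M) ((L : ℝ) ^ d) (fun k => calGlev L M a ha k * Pmodel L M V k * calGlev L M a ha k) k‖
      ≤ ((2 * (d * (α + β) * Cst d a) * CJ d a + C2model d L a α β) + (d * (α + β) * Cst d a) * (2 * d * Cst d a + 2 * (d * L * Cst d a)))
          * ((L : ℝ)⁻¹) ^ k := by
    intro k
    refine (opNorm_avgTow_step_le_of_law hr (opNorm_QBlev_sq_le L M) hlaw k).trans (le_of_eq ?_)
    simp only [Nat.cast_one, pow_one, Nat.sub_self, pow_zero]
    ring
  -- the size of the insertion tower: `‖ċ_k‖ ≤ ‖𝒢P𝒢‖ ≤ κ·Cst`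
  have hXm : ∀ k, ‖avgTow (QBlev L M) ((L : ℝ) ^ d) (fun k => calGlev L M a ha k * Pmodel L M V k * calGlev L M a ha k) k‖
      ≤ (d * (α + β) * Cst d a) * Cst d a := by
    intro k
    refine (opNorm_avgTow_le hr (opNorm_QBlev_sq_le L M) _ k).trans ?_
    have h1 : ‖calGlev L M a ha k * Pmodel L M V k‖ ≤ d * (α + β) * Cst d a := by
      rw [← calDalev_inv]; exact hpert.opNorm_inv_mul_P_le k
    have h2 : ‖calGlev L M a ha k‖ ≤ Cst d a := by rw [← calDalev_inv]; exact opNorm_inv_calDalev_le L M a ha k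
    exact (Matrix.l2_opNorm_mul _ _).trans (mul_le_mul h1 h2 (norm_nonneg _) ((norm_nonneg _).trans h1))
  exact effIns_tendsto_of_geom (cc := unitCovB L M a ha) (fun k => (isUnit_det_unitCovB_and_opNorm_inv_le L M a ha k).1)
    (fun k => (isUnit_det_unitCovB_and_opNorm_inv_le L M a ha k).2) hXm hρ1 hcc hXX

/-- **THE TWO INPUTS OF THE PERTURBED EFFECTIVE-FORM TOWER ON BAŁABAN's AVERAGED TOWER, BOTH THEOREMS** [our proof]: for a `PerturbationLaws (Δ_a^{(·)}) P J κ (C₂L^{−k})` family,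
`‖t‖κ < 1` and the Neumann smallness `γ_B⁻¹·‖t‖κCst(1 − ‖t‖κ)⁻¹ ≤ θ < 1`: (i) the one-step bound of the perturbed block propagators `c_k(t) = (L^d)^k·QB^{(k)}(Δ_a^{(k)} + tP_k)⁻¹QB^{(k)ᴴ}`,
`‖c_{k+1}(t) − c_k(t)‖ ≤ Cpert(t)·L^{−k}` (`oneStepAveragedLaw_perturbed` over `freeTowerLaws_balaban`), and (ii) their UB letter `‖c_k(t)⁻¹‖ ≤ γ_B⁻¹(1 − θ)⁻¹` (invertibility included),
from `uniformCoercive_unitCovB` by the Neumann transfer of §4 and `opNorm_avgTow_perturbed_sub_le`. -/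
theorem perturbedTower_balaban_bounds {P : (k : ℕ) → Matrix (idx L M k) (idx L M k) ℂ} {κ C₂ : ℝ}
    (hpert : PerturbationLaws (calDalev L M a ha) P (JpcT L M) κ (fun k => C₂ * ((L : ℝ)⁻¹) ^ k)) {t : ℂ} (ht : ‖t‖ * κ < 1) {θ : ℝ}
    (hθ : (gammaB d a)⁻¹ * (‖t‖ * κ * Cst d a * (1 - ‖t‖ * κ)⁻¹) ≤ θ) (hθ1 : θ < 1) :
    (∀ k, ‖avgTow (QBlev L M) ((L : ℝ) ^ d) (fun k => (calDalev L M a ha k + t • P k)⁻¹) (k + 1)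
        - avgTow (QBlev L M) ((L : ℝ) ^ d) (fun k => (calDalev L M a ha k + t • P k)⁻¹) k‖
        ≤ Cpert κ (2 * d * Cst d a) (CJ d a) C₂ (d * L * Cst d a) t * ((L : ℝ)⁻¹) ^ k) ∧
    (∀ k, IsUnit (avgTow (QBlev L M) ((L : ℝ) ^ d) (fun k => (calDalev L M a ha k + t • P k)⁻¹) k).det ∧
        ‖(avgTow (QBlev L M) ((L : ℝ) ^ d) (fun k => (calDalev L M a ha k + t • P k)⁻¹) k)⁻¹‖ ≤ (gammaB d a)⁻¹ * (1 - θ)⁻¹) := by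
  have hr : (0 : ℝ) < (L : ℝ) ^ d := pow_pos (by exact_mod_cast Nat.pos_of_ne_zero (NeZero.ne L)) d
  have hlaw := oneStepAveragedLaw_perturbed hr (freeTowerLaws_balaban L M a ha) hpert ht
  refine ⟨fun k => ?_, fun k => ?_⟩
  · refine (opNorm_avgTow_step_le_of_law hr (opNorm_QBlev_sq_le L M) hlaw k).trans ?_
    exact Epert_le_Cpert ht (fun k => le_rfl) (fun k => le_rfl) (fun k => le_rfl) (fun k => le_rfl) k
  · have hγ : ∀ k, ‖(calDalev L M a ha k)⁻¹‖ ≤ ((Cst d a)⁻¹)⁻¹ := fun k => by rw [inv_inv]; exact opNorm_inv_calDalev_le L M a ha k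
    have e0 : avgTow (QBlev L M) ((L : ℝ) ^ d) (fun k => (calDalev L M a ha k)⁻¹) k = unitCovB L M a ha k := by
      unfold unitCovB; congr 1; funext j; rw [calDalev_inv]
    have h := opNorm_avgTow_perturbed_sub_le hr (opNorm_QBlev_sq_le L M) (isUnit_det_calDalev L M a ha) hγ hpert.opNorm_P_mul_inv_le
      hpert.opNorm_inv_mul_P_le ht k
    rw [e0, inv_inv] at h
    exact isUnit_det_and_opNorm_inv_le_of_near (isUnit_det_unitCovB_and_opNorm_inv_le L M a ha k).1
      (isUnit_det_unitCovB_and_opNorm_inv_le L M a ha k).2 h hθ hθ1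

/-- **`effForm_perturbed_balaban` — ROUTE R6's END WITH (PERTURBATIVE) BACKGROUND, UNCONDITIONAL FOR SMALL COUPLING** [our proof] (`L ≥ 2`): for EVERY perturbation family with
`PerturbationLaws (Δ_a^{(·)}) P J κ (C₂L^{−k})` (today: the first-order model unconditionally; Bałaban's shaped operator conditionally on node NE3's binder), every coupling with
`‖t‖κ < 1` and `γ_B⁻¹·‖t‖κCst(1 − ‖t‖κ)⁻¹ ≤ θ < 1`: the effective forms `Σ_k(t) = c_k(t)⁻¹ − a′•1` of the perturbed unit-lattice block propagators CONVERGE — operator norm, hence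
ENTRYWISE — with `‖Σ_k(t) − Σ_∞(t)‖ ≤ (γ_B⁻¹(1 − θ)⁻¹)²·Cpert(t)·L^{−k}/(1 − L^{−1})`, `Cpert(t) = (CJ + ‖t‖C₂)(1 − ‖t‖κ)^{−2} + (2dCst + 2dLCst)(1 − ‖t‖κ)^{−1}`.  NO letter: no
(STAB)^{cov} schedule, no (CONS), no `τ_j`, no UB hypothesis. -/
theorem effForm_perturbed_balaban (hL : 2 ≤ L) {P : (k : ℕ) → Matrix (idx L M k) (idx L M k) ℂ} {κ C₂ : ℝ}
    (hpert : PerturbationLaws (calDalev L M a ha) P (JpcT L M) κ (fun k => C₂ * ((L : ℝ)⁻¹) ^ k)) {t : ℂ} (ht : ‖t‖ * κ < 1) {θ : ℝ}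
    (hθ : (gammaB d a)⁻¹ * (‖t‖ * κ * Cst d a * (1 - ‖t‖ * κ)⁻¹) ≤ θ) (hθ1 : θ < 1) (a' : ℂ) :
    ∃ Slim : Matrix (idx L M 0) (idx L M 0) ℂ,
      Tendsto (fun k => (avgTow (QBlev L M) ((L : ℝ) ^ d) (fun k => (calDalev L M a ha k + t • P k)⁻¹) k)⁻¹ - a' • (1 : Matrix (idx L M 0) (idx L M 0) ℂ))
        atTop (𝓝 Slim) ∧
      ∀ k, ‖((avgTow (QBlev L M) ((L : ℝ) ^ d) (fun k => (calDalev L M a ha k + t • P k)⁻¹) k)⁻¹ - a' • (1 : Matrix (idx L M 0) (idx L M 0) ℂ)) - Slim‖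
        ≤ ((gammaB d a)⁻¹ * (1 - θ)⁻¹) ^ 2 * Cpert κ (2 * d * Cst d a) (CJ d a) C₂ (d * L * Cst d a) t * ((L : ℝ)⁻¹) ^ k / (1 - (L : ℝ)⁻¹) := by
  have hL1 : (1 : ℝ) < L := by exact_mod_cast (lt_of_lt_of_le one_lt_two hL : 1 < L)
  obtain ⟨hcc, hUB⟩ := perturbedTower_balaban_bounds L M a ha hpert ht hθ hθ1
  exact effForm_tendsto_of_geom (cc := fun k => avgTow (QBlev L M) ((L : ℝ) ^ d) (fun k => (calDalev L M a ha k + t • P k)⁻¹) k)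
    (fun k => (hUB k).1) (fun k => (hUB k).2) (inv_lt_one_of_one_lt₀ hL1) hcc a'

/-- entrywise, two finite levels, same hypotheses: `‖Σ_{k+1}(t)(i,j) − Σ_k(t)(i,j)‖ ≤ (γ_B⁻¹(1 − θ)⁻¹)²·Cpert(t)·L^{−k}` — R6's END SHAPE `|𝒮_{j+1}(a,b) − 𝒮_j(a,b)| ≤ cst·θ^j` WITH
(perturbative) background, NO letter. [our proof] -/
theorem effForm_entry_step_perturbed_balaban {P : (k : ℕ) → Matrix (idx L M k) (idx L M k) ℂ} {κ C₂ : ℝ}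
    (hpert : PerturbationLaws (calDalev L M a ha) P (JpcT L M) κ (fun k => C₂ * ((L : ℝ)⁻¹) ^ k)) {t : ℂ} (ht : ‖t‖ * κ < 1) {θ : ℝ}
    (hθ : (gammaB d a)⁻¹ * (‖t‖ * κ * Cst d a * (1 - ‖t‖ * κ)⁻¹) ≤ θ) (hθ1 : θ < 1) (a' : ℂ) (k : ℕ) (i j : idx L M 0) :
    ‖((avgTow (QBlev L M) ((L : ℝ) ^ d) (fun k => (calDalev L M a ha k + t • P k)⁻¹) (k + 1))⁻¹ - a' • (1 : Matrix (idx L M 0) (idx L M 0) ℂ)) i j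
        - ((avgTow (QBlev L M) ((L : ℝ) ^ d) (fun k => (calDalev L M a ha k + t • P k)⁻¹) k)⁻¹ - a' • (1 : Matrix (idx L M 0) (idx L M 0) ℂ)) i j‖
      ≤ ((gammaB d a)⁻¹ * (1 - θ)⁻¹) ^ 2 * (Cpert κ (2 * d * Cst d a) (CJ d a) C₂ (d * L * Cst d a) t * ((L : ℝ)⁻¹) ^ k) := by
  obtain ⟨hcc, hUB⟩ := perturbedTower_balaban_bounds L M a ha hpert ht hθ hθ1
  exact norm_effForm_entry_step_le (cc := fun k => avgTow (QBlev L M) ((L : ℝ) ^ d) (fun k => (calDalev L M a ha k + t • P k)⁻¹) k)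
    (fun k => (hUB k).1) (fun k => (hUB k).2) hcc a' k i j

end Balaban

end Summit.QuantumFields.BalabanUV.Beta.GAN24.EffectiveFormInsertionLaw

end
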